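import Mathlib.RingTheory.Flat.EquationalCriterion
import Mathlib.RingTheory.Flat.TorsionFree
import Mathlib.RingTheory.DiscreteValuationRing.Basic
import Mathlib.RingTheory.Filtration
import Mathlib.RingTheory.Ideal.Over
import HarnessLib

/-!
# [OURS · L1 W4.5(b) · (T-k) discharge, piece J3] Flatness over a DVR from flatness of all truncations

Cell `res-hironaka`, LADDER-RESOLUTION rung L (D-0089), slot W4.5(b), crux chain w45b: working crux
`Theses.EquisingularLift.EquisingularLiftNat` (stmt-ResolutionOfSingularities-20038) / child `EquisingularLiftNatThree`
(stmt-ResolutionOfSingularities-20148). The NINETEENTH/TWENTIETH registrations isolate the hypothesis-residue (T-k) `EmbeddedCurveLiftFact`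
(…NatTowerRoundFourDefs); res-type-027 g16's census `Cruxes/EquisingularLiftNatThree/Lines/TK-CENSUS-res-type-027.md` reduces it to an
infinitesimal NEED-FACT (J1, Hartshorne 2010 Thm 6.2), Grothendieck existence (F-88, in the tree) and **J3 = flatness of the algebraized limit**.
This file proves J3 in the form the DVR base allows (the «DVR shortcut» of the census §J3, route written out by res-L1-w45b-stub-3 g7, STATUS
2026-08-28T01:58:26Z): a Noetherian local algebra `B` over a discrete valuation ring `O` with LOCAL structure map is flat over `O` as soon as every
truncation `B ⧸ 𝔪ⁿ⁺¹B` is flat over `O ⧸ 𝔪ⁿ⁺¹`.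

MATHEMATICS. Over the principal ideal domain `O`, flat = torsion-free (Mathlib `Module.Flat.flat_iff_torsion_eq_bot_of_isBezout`); a nonzero
`r ∈ O` is `unit · ϖᵐ`, so it suffices that `ϖ` is a nonzerodivisor on `B`. If `ϖ b = 0`, then for every `n` the class of `b` in the flat
`O ⧸ 𝔪ⁿ⁺¹`-module `B ⧸ 𝔪ⁿ⁺¹B` is killed by `ϖ̄`, hence (EQUATIONAL CRITERION, Mathlib `Module.Flat.isTrivialRelation_of_sum_smul_eq_zero`) is a
combination `Σ c̄ⱼ ȳⱼ` with `ϖ̄ c̄ⱼ = 0` in `O ⧸ 𝔪ⁿ⁺¹`, i.e. `cⱼ ∈ (ϖⁿ)`; so `b ∈ ϖⁿB + ϖⁿ⁺¹B = ϖⁿB` for all `n`, and `⋂ₙ ϖⁿB ⊆ ⋂ₙ 𝔪_Bⁿ = 0`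
(Krull, Mathlib `Ideal.iInf_pow_eq_bot_of_isLocalRing`). This is EGA 0_III (10.2.6) in the special case of a DVR base, proved, not cited.

`--supports stmt-ResolutionOfSingularities-20148 --as helper`. OURS; NOT a statement of any manuscript; AI-written, and AI review is weaker than
expert review. No `sorry`, standard axioms, DEF-FREE.

References (index only): A. Grothendieck, EGA III₁ (Publ. IHÉS 11, 1961), 0_III Prop. (10.2.6); The Stacks Project, Tag 00HK (equational
criterion), Tag 0539.
-/

set_option linter.dupNamespace false -- mandated namespace `Summit.<Summit>.<Problem>` of this single-conjunct summit

namespace Summit.ResolutionOfSingularities.ResolutionOfSingularities.Cruxes.EquisingularLiftNat.Sections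

open IsLocalRing

universe u v

/-- **Equational criterion, one relation**: in a flat module, `a • x = 0` forces `x = Σⱼ cⱼ • yⱼ` with `a cⱼ = 0` for all `j`.
[cite: StacksProject, Tag 00HK] -/
theorem exists_sum_smul_of_smul_eq_zero {A : Type u} {N : Type v} [CommRing A] [AddCommGroup N] [Module A N] [Module.Flat A N]
    {a : A} {x : N} (h : a • x = 0) :
    ∃ (k : ℕ) (c : Fin k → A) (y : Fin k → N), x = ∑ j, c j • y j ∧ ∀ j, a * c j = 0 := by
  have h' : ∑ i : Fin 1, (fun _ : Fin 1 => a) i • (fun _ : Fin 1 => x) i = 0 := by simpa using h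
  obtain ⟨k, c, y, hx, hc⟩ := Module.Flat.isTrivialRelation_of_sum_smul_eq_zero h'
  exact ⟨k, c 0, y, hx 0, fun j => by simpa using hc j⟩

variable {O : Type u} [CommRing O] [IsDomain O] [IsDiscreteValuationRing O]

/-- In a DVR with uniformiser `ϖ`: if `ϖ c ∈ 𝔪ⁿ⁺¹` then `c = ϖⁿ d` for some `d`. [folklore] -/
theorem exists_eq_pow_mul_of_mul_mem_pow {ϖ : O} (hϖ : Irreducible ϖ) {n : ℕ} {c : O}
    (h : ϖ * c ∈ maximalIdeal O ^ (n + 1)) : ∃ d : O, c = ϖ ^ n * d := by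
  rw [hϖ.maximalIdeal_eq, Ideal.span_singleton_pow, Ideal.mem_span_singleton'] at h
  obtain ⟨s, hs⟩ := h
  refine ⟨s, mul_left_cancel₀ hϖ.ne_zero ?_⟩
  rw [← hs]; ring

variable {B : Type v} [CommRing B] [Algebra O B]

/-- **Key step.** `ϖ b = 0` in `B` and `B ⧸ 𝔪ⁿ⁺¹B` flat over `O ⧸ 𝔪ⁿ⁺¹` ⇒ `b ∈ (ϖⁿ)B`. [folklore; EGA 0_III (10.2.6), DVR case] -/
theorem mem_span_pow_of_uniformizer_mul_eq_zero {ϖ : O} (hϖ : Irreducible ϖ) (n : ℕ)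
    [Module.Flat (O ⧸ maximalIdeal O ^ (n + 1)) (B ⧸ (maximalIdeal O ^ (n + 1)).map (algebraMap O B))]
    {b : B} (hb : algebraMap O B ϖ * b = 0) : b ∈ Ideal.span {algebraMap O B ϖ ^ n} := by
  set I : Ideal O := maximalIdeal O ^ (n + 1) with hI
  set π : B := algebraMap O B ϖ with hπ
  -- the class of `b` is killed by `ϖ̄`
  have h0 : (Ideal.Quotient.mk I ϖ) • (Ideal.Quotient.mk (I.map (algebraMap O B)) b) = 0 := by
    rw [Ideal.Quotient.mk_smul_mk_quotient_map_quotient, hb, map_zero]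
  obtain ⟨k, c, y, hx, hc⟩ := exists_sum_smul_of_smul_eq_zero h0
  -- lift the coefficients and the vectors
  choose c' hc' using fun j => Ideal.Quotient.mk_surjective (c j)
  choose y' hy' using fun j => Ideal.Quotient.mk_surjective (y j)
  -- `ϖ c'ⱼ ∈ I`, hence `c'ⱼ = ϖⁿ dⱼ`
  have hd : ∀ j, ∃ d : O, c' j = ϖ ^ n * d := by
    intro j
    apply exists_eq_pow_mul_of_mul_mem_pow hϖ
    rw [← Ideal.Quotient.eq_zero_iff_mem, map_mul, hc']
    exact hc j
  choose d hd using hd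
  -- `b - Σ ϖⁿ dⱼ y'ⱼ ∈ I·B = (ϖⁿ⁺¹)`
  have hdiff : b - ∑ j, algebraMap O B (ϖ ^ n * d j) * y' j ∈ I.map (algebraMap O B) := by
    rw [← Ideal.Quotient.eq, hx, map_sum]
    refine Finset.sum_congr rfl fun j _ => ?_
    rw [← hc', ← hy', Ideal.Quotient.mk_smul_mk_quotient_map_quotient, hd]
  have hIB : I.map (algebraMap O B) = Ideal.span {π ^ (n + 1)} := by
    rw [hI, hϖ.maximalIdeal_eq, Ideal.span_singleton_pow, Ideal.map_span, Set.image_singleton, map_pow]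
  rw [hIB] at hdiff
  -- conclude: `(ϖⁿ⁺¹) ≤ (ϖⁿ)` and each summand lies in `(ϖⁿ)`
  have hle : Ideal.span {π ^ (n + 1)} ≤ Ideal.span {π ^ n} :=
    Ideal.span_singleton_le_span_singleton.mpr (pow_dvd_pow π (Nat.le_succ n))
  have hsum : ∑ j, algebraMap O B (ϖ ^ n * d j) * y' j ∈ Ideal.span {π ^ n} := by
    refine Ideal.sum_mem _ fun j _ => ?_
    rw [map_mul, map_pow, mul_assoc]
    exact Ideal.mul_mem_right _ _ (Ideal.mem_span_singleton_self _)
  have := Ideal.add_mem _ (hle hdiff) hsum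
  simpa using this

variable [IsNoetherianRing B] [IsLocalRing B] [IsLocalHom (algebraMap O B)]

/-- `ϖ` is a nonzerodivisor on `B` when all truncations are flat. [folklore] -/
theorem eq_zero_of_uniformizer_mul_eq_zero {ϖ : O} (hϖ : Irreducible ϖ)
    (h : ∀ n : ℕ, Module.Flat (O ⧸ maximalIdeal O ^ (n + 1)) (B ⧸ (maximalIdeal O ^ (n + 1)).map (algebraMap O B)))
    {b : B} (hb : algebraMap O B ϖ * b = 0) : b = 0 := by
  set π : B := algebraMap O B ϖ
  -- `π ∈ 𝔪_B` (local structure map)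
  have hπ : π ∈ maximalIdeal B := by
    rw [mem_maximalIdeal, mem_nonunits_iff]
    intro hu
    exact hϖ.not_isUnit ((isUnit_map_iff (algebraMap O B) ϖ).mp hu)
  -- `b ∈ ⋂ₙ 𝔪_Bⁿ = 0`
  have hmem : b ∈ (⨅ n : ℕ, maximalIdeal B ^ n : Ideal B) := by
    refine Ideal.mem_iInf.mpr fun n => ?_
    haveI := h n
    have hn : b ∈ Ideal.span {π ^ n} := mem_span_pow_of_uniformizer_mul_eq_zero hϖ n hb
    have hle : Ideal.span {π ^ n} ≤ maximalIdeal B ^ n := by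
      rw [← Ideal.span_singleton_pow]
      exact Ideal.pow_right_mono ((Ideal.span_singleton_le_iff_mem _).mpr hπ) n
    exact hle hn
  rwa [Ideal.iInf_pow_eq_bot_of_isLocalRing _ (maximalIdeal.isMaximal B).ne_top, Ideal.mem_bot] at hmem

/-- **J3 (DVR shortcut of EGA 0_III (10.2.6)).** A Noetherian local algebra `B` over a discrete valuation ring `O` with local structure map, all of
whose truncations `B ⧸ 𝔪ⁿ⁺¹B` are flat over `O ⧸ 𝔪ⁿ⁺¹`, is flat over `O`. (Flat over a PID = torsion-free; a nonzero `r ∈ O` is `unit · ϖᵐ`;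
`ϖ` is a nonzerodivisor on `B` by `eq_zero_of_uniformizer_mul_eq_zero`.) [OURS · (T-k) discharge piece J3; proved] -/
theorem flat_of_forall_flat_quotient_pow
    (h : ∀ n : ℕ, Module.Flat (O ⧸ maximalIdeal O ^ (n + 1)) (B ⧸ (maximalIdeal O ^ (n + 1)).map (algebraMap O B))) :
    Module.Flat O B := by
  obtain ⟨ϖ, hϖ⟩ := IsDiscreteValuationRing.exists_irreducible O
  -- `ϖᵐ` is a nonzerodivisor on `B`
  have hpow : ∀ (m : ℕ) (b : B), algebraMap O B ϖ ^ m * b = 0 → b = 0 := by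
    intro m
    induction m with
    | zero => intro b hb; simpa using hb
    | succ m ih =>
      intro b hb
      apply ih
      apply eq_zero_of_uniformizer_mul_eq_zero hϖ h
      rw [← mul_assoc, ← pow_succ', hb]
  rw [Module.Flat.flat_iff_torsion_eq_bot_of_isBezout, eq_bot_iff]
  rintro b ⟨⟨r, hr⟩, hrb⟩
  rw [Submodule.mem_bot]
  have hr0 : (r : O) ≠ 0 := nonZeroDivisors.ne_zero hr
  obtain ⟨m, u, hu⟩ := IsDiscreteValuationRing.associated_pow_irreducible hr0 hϖ
  -- `ϖᵐ • b = u • (r • b) = 0`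
  have hrb' : (r : O) • b = 0 := hrb
  apply hpow m b
  rw [← map_pow, ← Algebra.smul_def, ← hu, mul_comm, mul_smul, hrb', smul_zero]

end Summit.ResolutionOfSingularities.ResolutionOfSingularities.Cruxes.EquisingularLiftNat.Sections
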